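import Literature.Computability.QuantumComplexity.GenKitAbstract
import Literature.Computability.QuantumComplexity.GRLevelWord
import Literature.Computability.QuantumComplexity.QFTBlockWord
import HarnessLib

/-!
# The flag programs of the Grover–Rudolph and Fourier gadgets are abstract

Topic `Literature/Computability/QuantumComplexity`; a companion of `GenKitAbstract.lean`: the classical flag programs
and flag wires of the two gadget words of Regev's sampler — `GRWord.grOps/grFlag` (the Grover–Rudolph level word over
`GenKit.kit ps dsz k`, `GRData.kit_eq`) and `QFTWord.phaseOps/phaseFlag` (the controlled-phase word over `QFTKit.kit κ k`)
— have the ℕ-valued form `gp.gopsA insA c` / `gp.gflagA c` of `GP` (by `GenKit.map_val_gadgetOps`,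
`QFTKit.map_val_gadgetOps`), with `insA` the input wires' values and `c` the compiler output of the gadget's program.
This is the shape `GP.gopsA_fp` (GenKitFP) computes on codes. Everything is proved; no named fact is introduced.

## References

* O. Regev, J. ACM 56(6) (2009), Lemma 3.14 (proof: uniformity), Lemma 3.12 [Regev2009].
* L. Grover, T. Rudolph, arXiv:quant-ph/0208112 (2002), eq. (5) [GroverRudolph2002].
* M. A. Nielsen, I. L. Chuang, *Quantum Computation and Quantum Information*, CUP 2010, §5.1 [NielsenChuang2010].
* S. Arora, B. Barak, *Computational Complexity: A Modern Approach*, CUP 2009, §6.2 [AroraBarak2009].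
-/

noncomputable section

namespace Literature.Computability.QuantumComplexity

open _root_.Computability Cryptography RevSim AJLCore GadgetKit

namespace GenKit

variable (ps : List SLP.BExpr) (dsz k : ℕ) (t : Fin (bsize ps dsz k)) (fs : Fin (kit ps dsz k).k ↪ Fin (bsize ps dsz k))

/-- The input wires of the Grover–Rudolph gadget, as numbers. [folklore] -/
theorem insGR_val : (GRWord.insGR t fs).map Fin.val = (t : ℕ) :: List.ofFn fun b => (fs b : ℕ) := by
  rw [GRWord.insGR, List.map_cons, List.map_ofFn]; rfl

/-- **The Grover–Rudolph flag program is abstract.** [cite: Regev2009, Lemma 3.14 (proof)] [cite: AroraBarak2009, §6.2] -/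
theorem map_val_grOps : (GRWord.grOps (kit ps dsz k) t fs).map (ClOp.map Fin.val) =
    (gpOf ps dsz k).gopsA ((GRWord.insGR t fs).map Fin.val) ((GRWord.prog k).compile (SLP.thrWd k) 0 0) :=
  map_val_gadgetOps ps dsz k (GRWord.insGR t fs) (GRWord.prog k)

/-- The Grover–Rudolph flag wire is abstract. [folklore] -/
theorem val_grFlag : (GRWord.grFlag (kit ps dsz k) t fs : ℕ) = (gpOf ps dsz k).gflagA ((GRWord.prog k).compile (SLP.thrWd k) 0 0) :=
  val_gadgetFlag ps dsz k (GRWord.insGR t fs) (GRWord.prog k)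

end GenKit

namespace QFTKit

variable (κ k : ℕ) (ws : Fin κ ↪ Fin (qbsize κ k)) (j l : Fin κ)

/-- The input wires of the phase gadget, as numbers. [folklore] -/
theorem insQFT_val : (QFTWord.insQFT (kit κ k) ws j l).map Fin.val = [(gpOf κ k).d0, (ws j : ℕ), (ws l : ℕ)] := rfl

/-- **The controlled-phase flag program is abstract.** [cite: Regev2009, Lemma 3.14 (proof)] [cite: NielsenChuang2010, §5.1] -/
theorem map_val_phaseOps : (QFTWord.phaseOps (kit κ k) ws j l).map (ClOp.map Fin.val) =
    (gpOf κ k).gopsA [(gpOf κ k).d0, (ws j : ℕ), (ws l : ℕ)] ((QFTWord.prog k j l).compile (SLP.thrWd k) 0 0) :=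
  map_val_gadgetOps κ k (QFTWord.insQFT (kit κ k) ws j l) (QFTWord.prog k j l)

/-- The controlled-phase flag wire is abstract. [folklore] -/
theorem val_phaseFlag : (QFTWord.phaseFlag (kit κ k) ws j l : ℕ) = (gpOf κ k).gflagA ((QFTWord.prog k j l).compile (SLP.thrWd k) 0 0) :=
  val_gadgetFlag κ k (QFTWord.insQFT (kit κ k) ws j l) (QFTWord.prog k j l)

/-- With the standard data embedding the inputs are `[κ % b, j, l]`-like numbers: `dataEmb κ k j` has value `j`. [folklore] -/
theorem map_val_phaseOps_dataEmb (j l : Fin κ) : (QFTWord.phaseOps (kit κ k) (dataEmb κ k) j l).map (ClOp.map Fin.val) =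
    (gpOf κ k).gopsA [(gpOf κ k).d0, (j : ℕ), (l : ℕ)] ((QFTWord.prog k j l).compile (SLP.thrWd k) 0 0) := by
  rw [map_val_phaseOps, dataEmb_val, dataEmb_val]

end QFTKit

end Literature.Computability.QuantumComplexity

end
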